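import Summits.HodgeConjecture.HodgeConjecture.Theorems.F0P2wThetaPartialLPole
import Literature.NumberTheory.LFunctions.PartialEulerProductSplitting
import HarnessLib

/-!
# W4 POLE with the places of degree `≥ 2` left unknown (ROAD-W v1 §2 W4, verbatim)

Cell `pub/hodgecm-mathlib`, crux H413 = `stmt-HodgeConjecture-24833`, P2 toe-hold L6-θ of ROAD-W v1 §2 W4:
«`L^S(s, π × μ′⁻¹)` has a SIMPLE POLE at `s₀ = 3/2` … except on the thin set of places of degree `≥ 2`
(absolutely convergent, harmless) … Places of degree `≥ 2` are thin and may stay unknown.»  THEOREMS ONLY;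
lane `--kind proof --supports stmt-HodgeConjecture-24833 --as helper`; touches no registry and no served Line;
count-neutral.  HONEST LABEL: HC_CM is proved only modulo the printed citations until rung 0 closes; this file
proves nothing about them.

THE STATEMENT (`exists_differentiableOn_sub_mul_partialStandardL_eq_of_thetaShape_degOne`).  Let `S₀` be a
FINITE set of finite places of the number field `K` and `α` a Satake family (★ `SatakeFamily`) such that
* at every place `v ∉ S₀` of residue degree `1` (`N(v)` a rational prime) `α v` is the theta shape
  `{√q_v, (√q_v)⁻¹, c v}` with `‖c v‖ ≤ 1` (the output of ★ `F0P2wThetaShapeOfWeight.thetaShape_of_weight` after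
  the `u`-twist — W1 purity + W2 congruence relation + W3 at the degree-one places), and
* at every other place `v ∉ S₀` (the UNKNOWN places) only `#(α v) ≤ n` and a bound `‖a‖ ≤ q_v^θ` with
  **`θ < 1`** are known.
Then `(s - 3/2) · L^{S₀}(s, α) = G(s)` on `re s > 3/2` for a function `G` holomorphic on the open half-plane
`{max (θ + 1/2) (5/4) < re s} ∋ 3/2` with `G(3/2) ≠ 0`, and `(s - 3/2) · L^{S₀}(s, α) → G(3/2) ≠ 0` as
`s → 3/2` within `re s > 3/2`: a SIMPLE POLE at `s₀ = 3/2 = n/2` (`n = 3`), the hypothesis of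
[Liu2021, App. B §B.2, Thm. B.4 (1)(a) p. 98] for the pole ⇒ theta machine.

THE PROOF (composition by name, ≈ 40 lines).  ★ `F0P2wThetaPartialLPole.exists_differentiableOn_sub_mul_thetaPartialL_eq`
(F0P2-p01 (g20)) at the THIN set `S = S₀ ∪ {v : N(v) not prime}` (thin at `σ₀ = 3/4` by ★
`F0P2wPartialDedekindZetaPole.summable_residueCard_rpow_neg_of_subset_finite_union_not_prime`) gives the
degree-one statement; ★ `Literature.NumberTheory.LFunctions.AbelianDensity.exists_eq_sub_mul_partialStandardL_of_degOne`
(pole transfer across the thin places, over ★ `ThinPlacesEulerProductHalfPlane`) multiplies by the thin Euler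
product, holomorphic and non-zero at `3/2` because `θ + 1/2 < 3/2`.  The weight bound `θ = 1/2` is admissible;
the trivial unitary bound `θ = 1` for `GL₃` is not (honest note of ★ `ThinPlacesEulerProductHalfPlane`).
-/
set_option autoImplicit false
set_option linter.dupNamespace false -- the mandated namespace repeats `HodgeConjecture.HodgeConjecture`

noncomputable section

open Filter Topology Complex NumberField IsDedekindDomain
open Literature.NumberTheory.Automorphic Literature.NumberTheory.LFunctions.AbelianDensity
open Summit.HodgeConjecture.HodgeConjecture.Cruxes.H413

namespace Summit.HodgeConjecture.HodgeConjecture.Cruxes.H413.F0P2wThetaPoleUnknownPlaces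

variable {K : Type} [Field K] [NumberField K]

/-- The theta shape `{√q, (√q)⁻¹, c}` with `‖c‖ ≤ 1` has three parameters. [folklore] -/
theorem card_thetaShape (v : HeightOneSpectrum (𝓞 K)) (c : ℂ) :
    Multiset.card ({((Real.sqrt v.residueCard : ℝ) : ℂ), ((Real.sqrt v.residueCard : ℝ) : ℂ)⁻¹, c} :
      Multiset ℂ) = 3 := by
  simp

/-- The theta shape `{√q, (√q)⁻¹, c}` with `‖c‖ ≤ 1` has parameters of norm `≤ q^{1/2}`. [folklore] -/
theorem norm_le_rpow_half_of_mem_thetaShape (v : HeightOneSpectrum (𝓞 K)) {c : ℂ} (hc : ‖c‖ ≤ 1) {a : ℂ}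
    (ha : a ∈ ({((Real.sqrt v.residueCard : ℝ) : ℂ), ((Real.sqrt v.residueCard : ℝ) : ℂ)⁻¹, c} :
      Multiset ℂ)) :
    ‖a‖ ≤ (v.residueCard : ℝ) ^ (1 / 2 : ℝ) := by
  have hq1 : (1 : ℝ) ≤ v.residueCard := by exact_mod_cast v.one_lt_residueCard.le
  have hq0 : (0 : ℝ) ≤ v.residueCard := zero_le_one.trans hq1
  have hsq : Real.sqrt (v.residueCard : ℝ) = (v.residueCard : ℝ) ^ (1 / 2 : ℝ) := Real.sqrt_eq_rpow _
  have hsq1 : (1 : ℝ) ≤ Real.sqrt (v.residueCard : ℝ) := by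
    rw [← Real.sqrt_one]
    exact Real.sqrt_le_sqrt hq1
  simp only [Multiset.insert_eq_cons, Multiset.mem_cons, Multiset.mem_singleton] at ha
  rcases ha with rfl | rfl | rfl
  · rw [Complex.norm_real, Real.norm_of_nonneg (Real.sqrt_nonneg _), hsq]
  · rw [norm_inv, Complex.norm_real, Real.norm_of_nonneg (Real.sqrt_nonneg _), ← hsq]
    exact (inv_le_one_of_one_le₀ hsq1).trans hsq1
  · rw [← hsq]
    exact hc.trans hsq1

/-- **W4 POLE with unknown places of degree `≥ 2`** (ROAD-W v1 §2 W4 made kernel): for a finite `S₀`, a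
Satake family of theta shape `{√q_v, (√q_v)⁻¹, c v}` (`‖c v‖ ≤ 1`) at the degree-one places off `S₀` and with
`#(α v) ≤ n`, `‖a‖ ≤ q_v^θ`, `θ < 1` at the other places off `S₀`, the partial Euler product `L^{S₀}(s, α)`
has a simple pole at `s₀ = 3/2`: `(s - 3/2) · L^{S₀}(s, α) = G(s)` on `re s > 3/2` with `G` holomorphic on
`{max (θ + 1/2) (5/4) < re}` and `G(3/2) ≠ 0`, and `(s - 3/2) · L^{S₀}(s, α) → G(3/2)` on `𝓝[re > 3/2] (3/2)`.
[cite: Liu2021, App. B §B.2, Thm. B.4 (1)(a) p. 98 with Cor. B.5–B.6 pp. 98–99 (the pole hypothesis, `n = 3`, `s₀ = n/2`)] -/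
theorem exists_differentiableOn_sub_mul_partialStandardL_eq_of_thetaShape_degOne
    {S₀ : Set (HeightOneSpectrum (𝓞 K))} (hS₀ : S₀.Finite) {α : SatakeFamily K}
    {c : HeightOneSpectrum (𝓞 K) → ℂ} {θ : ℝ} (hθ : θ < 1) {n : ℕ}
    (hc : ∀ v, v ∉ S₀ → (Ideal.absNorm v.asIdeal).Prime → ‖c v‖ ≤ 1)
    (hα : ∀ v, v ∉ S₀ → (Ideal.absNorm v.asIdeal).Prime →
      α v = {((Real.sqrt v.residueCard : ℝ) : ℂ), ((Real.sqrt v.residueCard : ℝ) : ℂ)⁻¹, c v})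
    (hcard : ∀ v, v ∉ S₀ → ¬ (Ideal.absNorm v.asIdeal).Prime → Multiset.card (α v) ≤ n)
    (hαθ : ∀ v, v ∉ S₀ → ¬ (Ideal.absNorm v.asIdeal).Prime → ∀ a ∈ α v, ‖a‖ ≤ (v.residueCard : ℝ) ^ θ) :
    ∃ G : ℂ → ℂ, DifferentiableOn ℂ G {s : ℂ | max (θ + 1 / 2) (5 / 4) < s.re} ∧ G (3 / 2) ≠ 0 ∧
      (∀ s : ℂ, 3 / 2 < s.re → (s - 3 / 2) * partialStandardL S₀ α s = G s) ∧
      Tendsto (fun s : ℂ => (s - 3 / 2) * partialStandardL S₀ α s) (𝓝[{s : ℂ | 3 / 2 < s.re}] (3 / 2 : ℂ))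
        (𝓝 (G (3 / 2))) := by
  -- the degree-one statement at the thin set `S = S₀ ∪ {v : N(v) not prime}` (F0P2-p01 (g20))
  have hthin : Summable fun v : (S₀ ∪ {v : HeightOneSpectrum (𝓞 K) | ¬ (Ideal.absNorm v.asIdeal).Prime} : Set _) =>
      ((v : HeightOneSpectrum (𝓞 K)).residueCard : ℝ) ^ (-(3 / 4 : ℝ)) :=
    F0P2wPartialDedekindZetaPole.summable_residueCard_rpow_neg_of_subset_finite_union_not_prime hS₀
      subset_rfl (by norm_num)
  have hcS : ∀ v, v ∉ S₀ ∪ {v : HeightOneSpectrum (𝓞 K) | ¬ (Ideal.absNorm v.asIdeal).Prime} → ‖c v‖ ≤ 1 :=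
    fun v hv => hc v (fun h => hv (Or.inl h)) (by_contra fun h => hv (Or.inr h))
  have hαS : ∀ v, v ∉ S₀ ∪ {v : HeightOneSpectrum (𝓞 K) | ¬ (Ideal.absNorm v.asIdeal).Prime} →
      α v = {((Real.sqrt v.residueCard : ℝ) : ℂ), ((Real.sqrt v.residueCard : ℝ) : ℂ)⁻¹, c v} :=
    fun v hv => hα v (fun h => hv (Or.inl h)) (by_contra fun h => hv (Or.inr h))
  obtain ⟨G, hG, hG0, hGeq⟩ :=
    F0P2wThetaPartialLPole.exists_differentiableOn_sub_mul_thetaPartialL_eq hthin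
      (by norm_num) (by norm_num) hcS hαS
  -- uniform degree bound off `S₀`
  have hcard' : ∀ v, v ∉ S₀ → Multiset.card (α v) ≤ max n 3 := by
    intro v hv
    by_cases hp : (Ideal.absNorm v.asIdeal).Prime
    · rw [hα v hv hp, card_thetaShape]
      exact le_max_right _ _
    · exact (hcard v hv hp).trans (le_max_left _ _)
  have hα₁ : ∀ v, v ∉ S₀ → (Ideal.absNorm v.asIdeal).Prime → ∀ a ∈ α v,
      ‖a‖ ≤ (v.residueCard : ℝ) ^ (1 / 2 : ℝ) := by
    intro v hv hp a ha
    rw [hα v hv hp] at ha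
    exact norm_le_rpow_half_of_mem_thetaShape v (hc v hv hp) ha
  -- pole transfer across the thin places (★ `exists_eq_sub_mul_partialStandardL_of_degOne`)
  have h32 : ((3 / 2 : ℂ)).re = 3 / 2 := by norm_num
  have hUo : IsOpen {s : ℂ | max (θ + 1 / 2) (5 / 4) < s.re} :=
    isOpen_lt continuous_const Complex.continuous_re
  have hs₀U : (3 / 2 : ℂ) ∈ {s : ℂ | max (θ + 1 / 2) (5 / 4) < s.re} := by
    show max (θ + 1 / 2) (5 / 4) < (3 / 2 : ℂ).re
    rw [h32]
    exact max_lt (by linarith) (by norm_num)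
  have hUsub : {s : ℂ | max (θ + 1 / 2) (5 / 4) < s.re} ⊆ {s : ℂ | θ + 1 / 2 < s.re} := by
    intro s hs
    show θ + 1 / 2 < s.re
    exact lt_of_le_of_lt (le_max_left _ _) hs
  have hGU : DifferentiableOn ℂ G {s : ℂ | max (θ + 1 / 2) (5 / 4) < s.re} :=
    hG.mono fun s hs => by
      show (3 / 4 : ℝ) + 1 / 2 < s.re
      have : (5 / 4 : ℝ) < s.re := lt_of_le_of_lt (le_max_right _ _) hs
      linarith
  have hGeq' : ∀ s : ℂ, (3 / 2 : ℂ).re < s.re →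
      (s - 3 / 2) * partialStandardL (S₀ ∪ {v | ¬ (Ideal.absNorm v.asIdeal).Prime}) α s = G s := by
    intro s hs
    rw [h32] at hs
    exact hGeq s hs
  obtain ⟨G', hG'd, hG'eq, hT0, hid, hlim⟩ :=
    exists_eq_sub_mul_partialStandardL_of_degOne (S₀ := S₀) (α := α) (θ := θ) (θ₁ := 1 / 2) (n := max n 3)
      hcard' hαθ hα₁ (s₀ := (3 / 2 : ℂ)) (by rw [h32]; linarith) (by rw [h32]; norm_num)
      hUo hs₀U hUsub hGU hGeq'
  refine ⟨G', hG'd, ?_, fun s hs => hid s (by rw [h32]; exact hs), ?_⟩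
  · rw [hG'eq]
    exact mul_ne_zero hG0 hT0
  · rw [hG'eq]
    have hset : {s : ℂ | (3 / 2 : ℂ).re < s.re} = {s : ℂ | 3 / 2 < s.re} := by
      ext s
      simp only [Set.mem_setOf_eq, h32]
    rw [hset] at hlim
    exact hlim

end Summit.HodgeConjecture.HodgeConjecture.Cruxes.H413.F0P2wThetaPoleUnknownPlaces

end
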